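import Literature.AnabelianGeometry.AbsoluteAnabelian.AbsTopII.DehnTwistLoopDatum
import Literature.AnabelianGeometry.AbsoluteAnabelian.AbsTopII.InertiaGroupsBranchScope
import Literature.AnabelianGeometry.AbsoluteAnabelian.AbsTopII.FreeProcyclicBridge
import Literature.AnabelianGeometry.AbsoluteAnabelian.ZHatCompletionFreeProcyclic
import HarnessLib

/-!
# [AbsTopII] Prop 1.3 (ii)/(iii) at the NODAL model, stage S3a: the inertia groups of the Dehn-twist datum

S. Mochizuki, *Topics in Absolute Anabelian Geometry II* [AbsTopII] (bib `MochizukiAbsTopII2013`; locators =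
PDF pages of the kurims manuscript `paper:url-585b8d0ad0d9`), §1, Def 1.2 (ii) p. 10 (`I_v := Z_{Π_I}(Π_v)`,
`I_e := Z_{Π_I}(Π_e)`), Prop 1.3 (ii) p. 11 ("`1 → Π_e → I_e → I → 1`; as abstract profinite groups,
`I_e ≅ Ẑ^Σ × Ẑ^Σ`"), (iii) p. 11 ("we have a natural isomorphism `I_v ⥲ I`").

PROOF-ONLY (no definition), abc-iut-L4-t6 lineage, row «DPSC-NODAL-MODEL» stage S3a, over S1
(`DehnTwistExtension.lean`: `Π_I = F̂₂ ⋊_{shear^i} Ẑ`) and S2 (`DehnTwistLoopDatum.lean`: the loop-graph PSC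
datum `loopDatum` and `dpsc i hi`).  At the FIRST DPSC datum WITH A NODE, first as plain statements in
`Π_I = Ext i` (all types `Subgroup (Ext i)`), then transferred verbatim to the `DPSCIndexData` vocabulary of
`dpsc i hi` (the transfer is definitional: `dpsc_vertSub`, `dpsc_nodeSub`, `dpsc_PiG`, `dpsc_PiI` are `rfl`):

* `mem_centralizer_map_inl_iff` — `(n, k)` centralises `S × 1`, for `S ⊆ F̂₂` FIXED POINTWISE by the twist,
  iff `n ∈ Z_{F̂₂}(S)`; the twist fixes `Π_e = b^Ẑ` and `Π_v = ⟨b^Ẑ, ab^Ẑa⁻¹⟩^` pointwise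
  (`shearPow_mem_nodeGp`, `shearPow_mem_vertGp`);
* **`I_v = 1 ⋊ Ẑ`** given `Z_{F̂₂}(Π_v) = 1` (`Iv_dpsc_eq_range_inr`): the printed "`I_v ⥲ I`" — the INPUT
  «`I_v · Π_𝔾 = Π_I`» (I-surjectivity) taken BY NAME by every abstract closer of this sub-DAG is DISCHARGED
  by the Dehn twist (`Iv_sup_PiG_dpsc`), and `I_v ∩ Π_𝔾 = 1` (`Iv_inf_PiG_dpsc`);
* **Prop 1.3 (ii), first clause, NON-IDLE** (there IS a node): `Π_e ≤ I_e`, `I_e ∩ Π_𝔾 = Π_e`,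
  `I_e · Π_𝔾 = Π_I`, given `Z_{F̂₂}(b^Ẑ) = b^Ẑ` (`prop_1_3_ii_clause1_dpsc`) — `I_e = b^Ẑ ⋊ Ẑ`;
* **Prop 1.3 (ii), second clause, NON-IDLE**: `I_e` is the internal direct product of the closed free
  pro-`𝔓𝔯𝔦𝔪𝔢𝔰`-cyclic subgroups `Π_e = b^Ẑ × 1` and `I_v = 1 × Ẑ` (`prop_1_3_ii_clause2_dpsc`).
The two centraliser inputs are hypotheses BY NAME ([CombGC] Prop 1.2 (ii) for the node group `b^Ẑ`;
triviality of `Z_{F̂₂}(Π_v)`); the BRANCH-PAIR clause (index `i^Σ_e = i`) is stage S3b.  HONEST FRAMING: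
classical group theory in a constructed model (constructed ≠ geometric); typed ≠ proved for the named
inputs; nothing here bears on [IUTchIII] Cor 3.12.
-/

noncomputable section

open scoped Pointwise

namespace Literature.AnabelianGeometry.AbsoluteAnabelian.AbsTopII.DehnTwist

open Literature.AnabelianGeometry.EtaleTheta.SettingModel
open Literature.AnabelianGeometry.SemiGraphs
open Literature.AnabelianGeometry.Anabelioids (IsSigmaInteger)
open _root_.Topology

variable (i : ℕ)

/-! ### Centralisers of `S × 1` in `F̂₂ ⋊ Ẑ` for twist-fixed `S` -/

/-- In `Π_I = F̂₂ ⋊_{shear^i} Ẑ`: if the twist fixes the subgroup `S ⊆ F̂₂` pointwise, then `(n, k)` centralises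
`S × 1` iff `n` centralises `S` in `F̂₂`. [cite: MochizukiAbsTopII2013, Def 1.2 (ii) p.10] -/
theorem mem_centralizer_map_inl_iff {S : Subgroup F₂hatT} (hfix : ∀ (k : ZH), ∀ s ∈ S, shearPow i k s = s)
    (g : Ext i) :
    g ∈ Subgroup.centralizer ((S.map (SemidirectProduct.inl : F₂hatT →* Ext i) : Subgroup (Ext i)) :
        Set (Ext i)) ↔
      g.left ∈ Subgroup.centralizer (S : Set F₂hatT) := by
  rw [Subgroup.mem_centralizer_iff, Subgroup.mem_centralizer_iff]
  constructor
  · intro h s hs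
    have h1 := congrArg SemidirectProduct.left (h (SemidirectProduct.inl s) ⟨s, hs, rfl⟩)
    simp only [SemidirectProduct.mul_left, SemidirectProduct.left_inl, SemidirectProduct.right_inl, map_one,
      MulAut.one_apply] at h1
    rw [hfix g.right s hs] at h1
    exact h1
  · rintro h _ ⟨s, hs, rfl⟩
    refine SemidirectProduct.ext ?_ ?_
    · simp only [SemidirectProduct.mul_left, SemidirectProduct.left_inl, SemidirectProduct.right_inl, map_one,
        MulAut.one_apply]
      rw [hfix g.right s hs]
      exact h s hs
    · simp only [SemidirectProduct.mul_right, SemidirectProduct.right_inl, one_mul, mul_one]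

/-! ### The twist fixes `Π_e` and `Π_v` pointwise -/

/-- The twist fixes the node group `b^Ẑ` pointwise. [cite: MochizukiAbsTopII2013, Prop 1.3 (ii) p.11] -/
theorem shearPow_mem_nodeGp (k : ZH) : ∀ s ∈ nodeGp, shearPow i k s = s := by
  rintro _ ⟨t, rfl⟩
  exact shearPow_bPow i k t

/-- The twist fixes the second branch `a · b^Ẑ · a⁻¹` pointwise. [cite: MochizukiAbsTopII2013, Prop 1.3 (iii) p.11] -/
theorem shearPow_mem_conj_nodeGp (k : ZH) : ∀ s ∈ MulAut.conj genA • nodeGp, shearPow i k s = s := by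
  intro s hs
  rw [Subgroup.mem_smul_pointwise_iff_exists] at hs
  obtain ⟨_, ⟨t, rfl⟩, rfl⟩ := hs
  change shearPow i k (eta (FreeGroup.of 0) * bPow t * (eta (FreeGroup.of 0))⁻¹) =
    eta (FreeGroup.of 0) * bPow t * (eta (FreeGroup.of 0))⁻¹
  rw [map_mul, map_mul, map_inv, shearPow_eta_zero, shearPow_bPow]
  have hcomm : bPow (k ^ i) * bPow t = bPow t * bPow (k ^ i) := by
    rw [← map_mul, ← map_mul, Literature.AnabelianGeometry.AbsoluteAnabelian.ZHatCompletion.mul_comm]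
  calc eta (FreeGroup.of 0) * bPow (k ^ i) * bPow t * (eta (FreeGroup.of 0) * bPow (k ^ i))⁻¹
      = eta (FreeGroup.of 0) * (bPow (k ^ i) * bPow t) * (bPow (k ^ i))⁻¹ * (eta (FreeGroup.of 0))⁻¹ := by
        group
    _ = eta (FreeGroup.of 0) * (bPow t * bPow (k ^ i)) * (bPow (k ^ i))⁻¹ * (eta (FreeGroup.of 0))⁻¹ := by
        rw [hcomm]
    _ = eta (FreeGroup.of 0) * bPow t * (eta (FreeGroup.of 0))⁻¹ := by group

/-- The twist fixes the verticial group `Π_v = ⟨b^Ẑ, ab^Ẑa⁻¹⟩^` pointwise (the fixed-point set of the continuous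
automorphism is a closed subgroup containing both branch images). [cite: MochizukiAbsTopII2013, Prop 1.3 (iii) p.11] -/
theorem shearPow_mem_vertGp (k : ZH) : ∀ s ∈ vertGp, shearPow i k s = s := by
  set F : Subgroup F₂hatT := ((shearPow i k).toMonoidHom).eqLocus (MonoidHom.id F₂hatT) with hF
  have hle : (bAxis ⊔ MulAut.conj genA • bAxis : Subgroup F₂hatT) ≤ F :=
    sup_le (fun s hs => shearPow_mem_nodeGp i k s hs) (fun s hs => shearPow_mem_conj_nodeGp i k s hs)
  have hFcl : IsClosed (F : Set F₂hatT) := by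
    have : (F : Set F₂hatT) = {x | shear (k ^ i) x = x} := by
      ext x; rfl
    rw [this]
    exact isClosed_eq (shear (k ^ i)).continuous continuous_id
  intro s hs
  exact Subgroup.topologicalClosure_minimal _ hle hFcl hs

/-! ### Statements in `Π_I = Ext i` -/

/-- `(n, k) ∈ Z_{Π_I}(Π_v × 1)` iff `n ∈ Z_{F̂₂}(Π_v)`. [cite: MochizukiAbsTopII2013, Def 1.2 (ii) p.10] -/
theorem mem_centralizer_vert_inf_top_iff (g : Ext i) :
    g ∈ Subgroup.centralizer ((vertGp.map (SemidirectProduct.inl : F₂hatT →* Ext i) : Subgroup (Ext i)) :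
        Set (Ext i)) ⊓ (⊤ : Subgroup (Ext i)) ↔
      g.left ∈ Subgroup.centralizer (vertGp : Set F₂hatT) := by
  rw [Subgroup.mem_inf, mem_centralizer_map_inl_iff i (shearPow_mem_vertGp i)]
  exact ⟨fun h => h.1, fun h => ⟨h, Subgroup.mem_top _⟩⟩

/-- `(n, k) ∈ Z_{Π_I}(Π_e × 1)` iff `n ∈ Z_{F̂₂}(b^Ẑ)`. [cite: MochizukiAbsTopII2013, Def 1.2 (ii) p.10] -/
theorem mem_centralizer_node_inf_top_iff (g : Ext i) :
    g ∈ Subgroup.centralizer ((nodeGp.map (SemidirectProduct.inl : F₂hatT →* Ext i) : Subgroup (Ext i)) :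
        Set (Ext i)) ⊓ (⊤ : Subgroup (Ext i)) ↔
      g.left ∈ Subgroup.centralizer (nodeGp : Set F₂hatT) := by
  rw [Subgroup.mem_inf, mem_centralizer_map_inl_iff i (shearPow_mem_nodeGp i)]
  exact ⟨fun h => h.1, fun h => ⟨h, Subgroup.mem_top _⟩⟩

/-- `Z_{Π_I}(Π_v × 1) = 1 ⋊ Ẑ` given `Z_{F̂₂}(Π_v) = 1`. [cite: MochizukiAbsTopII2013, Prop 1.3 (iii) p.11] -/
theorem centralizer_vert_inf_top_eq (hZv : Subgroup.centralizer (vertGp : Set F₂hatT) = ⊥) :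
    Subgroup.centralizer ((vertGp.map (SemidirectProduct.inl : F₂hatT →* Ext i) : Subgroup (Ext i)) :
        Set (Ext i)) ⊓ (⊤ : Subgroup (Ext i)) =
      (SemidirectProduct.inr : ZH →* Ext i).range := by
  ext g
  rw [mem_centralizer_vert_inf_top_iff, hZv, Subgroup.mem_bot, MonoidHom.mem_range]
  constructor
  · intro h1
    refine ⟨g.right, SemidirectProduct.ext ?_ ?_⟩
    · rw [SemidirectProduct.left_inr, h1]
    · rw [SemidirectProduct.right_inr]
  · rintro ⟨k, rfl⟩
    exact SemidirectProduct.left_inr k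

/-- `(1 ⋊ Ẑ) · (F̂₂ × 1) = Π_I`. [cite: MochizukiAbsTopII2013, Prop 1.3 (iii) p.11] -/
theorem range_inr_sup_range_inl :
    (SemidirectProduct.inr : ZH →* Ext i).range ⊔ (SemidirectProduct.inl : F₂hatT →* Ext i).range = ⊤ := by
  rw [eq_top_iff]
  intro g _
  rw [← SemidirectProduct.inl_left_mul_inr_right g]
  exact Subgroup.mul_mem _ (Subgroup.mem_sup_right ⟨g.left, rfl⟩) (Subgroup.mem_sup_left ⟨g.right, rfl⟩)

/-- `(1 ⋊ Ẑ) ∩ (F̂₂ × 1) = 1`. [cite: MochizukiAbsTopII2013, Prop 1.3 (iii) p.11] -/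
theorem range_inr_inf_range_inl :
    (SemidirectProduct.inr : ZH →* Ext i).range ⊓ (SemidirectProduct.inl : F₂hatT →* Ext i).range = ⊥ := by
  rw [eq_bot_iff]
  rintro g ⟨⟨k, rfl⟩, ⟨n, hn⟩⟩
  have h := congrArg SemidirectProduct.right hn
  rw [SemidirectProduct.right_inl, SemidirectProduct.right_inr] at h
  rw [Subgroup.mem_bot, ← h, map_one]

/-- `Π_e × 1 ≤ Z_{Π_I}(Π_e × 1)` given `Z_{F̂₂}(b^Ẑ) = b^Ẑ`. [cite: MochizukiAbsTopII2013, Prop 1.3 (ii) p.11] -/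
theorem map_inl_node_le_centralizer (hZb : Subgroup.centralizer (nodeGp : Set F₂hatT) = nodeGp) :
    nodeGp.map (SemidirectProduct.inl : F₂hatT →* Ext i) ≤
      Subgroup.centralizer ((nodeGp.map (SemidirectProduct.inl : F₂hatT →* Ext i) : Subgroup (Ext i)) :
        Set (Ext i)) ⊓ (⊤ : Subgroup (Ext i)) := by
  rintro _ ⟨n, hn, rfl⟩
  rw [mem_centralizer_node_inf_top_iff, hZb, SemidirectProduct.left_inl]
  exact hn

/-- `1 ⋊ Ẑ ≤ Z_{Π_I}(Π_e × 1)` (the twist fixes `b^Ẑ`). [cite: MochizukiAbsTopII2013, Prop 1.3 (ii) p.11] -/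
theorem range_inr_le_centralizer :
    (SemidirectProduct.inr : ZH →* Ext i).range ≤
      Subgroup.centralizer ((nodeGp.map (SemidirectProduct.inl : F₂hatT →* Ext i) : Subgroup (Ext i)) :
        Set (Ext i)) ⊓ (⊤ : Subgroup (Ext i)) := by
  rintro _ ⟨k, rfl⟩
  rw [mem_centralizer_node_inf_top_iff, SemidirectProduct.left_inr]
  exact Subgroup.one_mem _

/-- **`I_e = b^Ẑ ⋊ Ẑ` in `Π_I`**: `Π_e × 1 ≤ Z`, `Z ∩ (F̂₂ × 1) = Π_e × 1`, `Z · (F̂₂ × 1) = Π_I` for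
`Z := Z_{Π_I}(Π_e × 1)`, given `Z_{F̂₂}(b^Ẑ) = b^Ẑ`. [cite: MochizukiAbsTopII2013, Prop 1.3 (ii) p.11] -/
theorem centralizer_node_clause1 (hZb : Subgroup.centralizer (nodeGp : Set F₂hatT) = nodeGp) :
    nodeGp.map (SemidirectProduct.inl : F₂hatT →* Ext i) ≤
        Subgroup.centralizer ((nodeGp.map (SemidirectProduct.inl : F₂hatT →* Ext i) : Subgroup (Ext i)) :
          Set (Ext i)) ⊓ (⊤ : Subgroup (Ext i)) ∧
      (Subgroup.centralizer ((nodeGp.map (SemidirectProduct.inl : F₂hatT →* Ext i) : Subgroup (Ext i)) :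
          Set (Ext i)) ⊓ (⊤ : Subgroup (Ext i))) ⊓ (SemidirectProduct.inl : F₂hatT →* Ext i).range =
        nodeGp.map (SemidirectProduct.inl : F₂hatT →* Ext i) ∧
      (Subgroup.centralizer ((nodeGp.map (SemidirectProduct.inl : F₂hatT →* Ext i) : Subgroup (Ext i)) :
          Set (Ext i)) ⊓ (⊤ : Subgroup (Ext i))) ⊔ (SemidirectProduct.inl : F₂hatT →* Ext i).range = ⊤ := by
  refine ⟨map_inl_node_le_centralizer i hZb, ?_, ?_⟩
  · apply le_antisymm
    · intro g hg
      rw [Subgroup.mem_inf] at hg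
      obtain ⟨hg, n, rfl⟩ := hg
      rw [mem_centralizer_node_inf_top_iff, hZb, SemidirectProduct.left_inl] at hg
      exact ⟨n, hg, rfl⟩
    · exact le_inf (map_inl_node_le_centralizer i hZb) (fun _ ⟨n, _, h⟩ => ⟨n, h⟩)
  · rw [eq_top_iff]
    intro g _
    rw [← SemidirectProduct.inl_left_mul_inr_right g]
    exact Subgroup.mul_mem _ (Subgroup.mem_sup_right ⟨g.left, rfl⟩)
      (Subgroup.mem_sup_left (range_inr_le_centralizer i ⟨g.right, rfl⟩))

/-- `Π_e × 1` is closed in `Π_I`. [cite: MochizukiAbsTopII2013, Prop 1.3 (ii) p.11] -/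
theorem isClosed_map_inl_node :
    IsClosed ((nodeGp.map (SemidirectProduct.inl : F₂hatT →* Ext i) : Subgroup (Ext i)) : Set (Ext i)) := by
  rw [Subgroup.coe_map]
  exact (isClosed_bAxis.isCompact.image (continuous_inl i)).isClosed

/-- `1 ⋊ Ẑ` is closed in `Π_I`. [cite: MochizukiAbsTopII2013, Prop 1.3 (iii) p.11] -/
theorem isClosed_range_inr :
    IsClosed (((SemidirectProduct.inr : ZH →* Ext i).range : Subgroup (Ext i)) : Set (Ext i)) := by
  rw [MonoidHom.coe_range]
  exact (isCompact_range (continuous_inr i)).isClosed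

/-- `IsSigmaInteger` for `Σ = 𝔓𝔯𝔦𝔪𝔢𝔰` and for `Σ = univ` both say "positive". [cite: MochizukiAbsTopII2013, Ex 1.1 (i) p.8] -/
theorem isSigmaInteger_primes_iff_univ (n : ℕ) :
    IsSigmaInteger {p | p.Prime} n ↔ IsSigmaInteger Set.univ n :=
  ⟨fun h => ⟨h.1, fun _ _ _ => Set.mem_univ _⟩, fun h => ⟨h.1, fun _ hp _ => hp⟩⟩

/-- A free procyclic group is free pro-`𝔓𝔯𝔦𝔪𝔢𝔰`-cyclic (bookkeeping between `Set.univ` and `{p | p.Prime}`).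
[cite: MochizukiAbsTopII2013, Prop 1.3 (i) p.11] -/
theorem isFreeProSigmaCyclic_primes_of_univ {G : Type} [Group G] [TopologicalSpace G]
    (h : IsFreeProSigmaCyclic Set.univ G) : IsFreeProSigmaCyclic {p | p.Prime} G :=
  ⟨h.exists_dense_zpowers, fun n => (h.isOpen_index_iff n).trans (isSigmaInteger_primes_iff_univ n).symm⟩

/-- `Ẑ` is free pro-`𝔓𝔯𝔦𝔪𝔢𝔰`-cyclic. [cite: MochizukiAbsTopII2013, Prop 1.3 (i) p.11] -/
theorem isFreeProSigmaCyclic_primes_ZH : IsFreeProSigmaCyclic {p | p.Prime} ZH :=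
  isFreeProSigmaCyclic_primes_of_univ
    (Literature.AnabelianGeometry.AbsoluteAnabelian.isFreeProcyclic_zHatCompletion.isFreeProSigmaCyclic_univ)

/-- The left component of an element of `Π_e × 1` lies in `b^Ẑ`. [cite: MochizukiAbsTopII2013, Def 1.2 (ii) p.10] -/
theorem left_mem_bAxis_of_mem_map_inl_node {g : Ext i}
    (hg : g ∈ nodeGp.map (SemidirectProduct.inl : F₂hatT →* Ext i)) : g.left ∈ (bAxis : Subgroup F₂hatT) := by
  obtain ⟨n, hn, rfl⟩ := hg
  exact hn

/-- The right component of an element of `Π_e × 1` is trivial. [cite: MochizukiAbsTopII2013, Def 1.2 (ii) p.10] -/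
theorem right_eq_one_of_mem_map_inl_node {g : Ext i}
    (hg : g ∈ nodeGp.map (SemidirectProduct.inl : F₂hatT →* Ext i)) : g.right = 1 := by
  obtain ⟨n, -, rfl⟩ := hg
  rfl

/-- `Π_e × 1 ≅ Ẑ` as topological groups: free pro-`𝔓𝔯𝔦𝔪𝔢𝔰`-cyclic. [cite: MochizukiAbsTopII2013, Prop 1.3 (ii) p.11] -/
theorem isFreeProSigmaCyclic_map_inl_node :
    IsFreeProSigmaCyclic {p | p.Prime} ↥(nodeGp.map (SemidirectProduct.inl : F₂hatT →* Ext i)) := by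
  have e1 : ↥(bAxis : Subgroup F₂hatT) ≃ₜ* ↥(nodeGp.map (SemidirectProduct.inl : F₂hatT →* Ext i)) :=
    { toFun := fun n =>
        ⟨SemidirectProduct.inl n.1,
          (⟨n.1, n.2, rfl⟩ : SemidirectProduct.inl n.1 ∈ nodeGp.map (SemidirectProduct.inl : F₂hatT →* Ext i))⟩
      invFun := fun g => ⟨g.1.left, left_mem_bAxis_of_mem_map_inl_node i g.2⟩
      left_inv := fun n => rfl
      right_inv := fun g =>
        Subtype.ext (SemidirectProduct.ext rfl (right_eq_one_of_mem_map_inl_node i g.2).symm)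
      map_mul' := fun m n => Subtype.ext (map_mul (SemidirectProduct.inl : F₂hatT →* Ext i) m.1 n.1)
      continuous_toFun := ((continuous_inl i).comp continuous_subtype_val).subtype_mk
        (fun n : ↥(bAxis : Subgroup F₂hatT) =>
          (⟨n.1, n.2, rfl⟩ : SemidirectProduct.inl n.1 ∈ nodeGp.map (SemidirectProduct.inl : F₂hatT →* Ext i)))
      continuous_invFun :=
        ((Semidirect.continuous_left (isInducing_leftRight i)).comp continuous_subtype_val).subtype_mk
          (fun g : ↥(nodeGp.map (SemidirectProduct.inl : F₂hatT →* Ext i)) =>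
            left_mem_bAxis_of_mem_map_inl_node i g.2) }
  exact (isFreeProSigmaCyclic_primes_ZH.of_continuousMulEquiv zHatEquivBAxis).of_continuousMulEquiv e1

/-- `1 ⋊ Ẑ ≅ Ẑ` as topological groups: free pro-`𝔓𝔯𝔦𝔪𝔢𝔰`-cyclic. [cite: MochizukiAbsTopII2013, Prop 1.3 (iii) p.11] -/
theorem isFreeProSigmaCyclic_range_inr :
    IsFreeProSigmaCyclic {p | p.Prime} ↥((SemidirectProduct.inr : ZH →* Ext i).range) := by
  have e2 : ZH ≃ₜ* ↥((SemidirectProduct.inr : ZH →* Ext i).range) :=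
    { toFun := fun k => ⟨SemidirectProduct.inr k, (⟨k, rfl⟩ : SemidirectProduct.inr k ∈
          (SemidirectProduct.inr : ZH →* Ext i).range)⟩
      invFun := fun g => g.1.right
      left_inv := fun k => rfl
      right_inv := fun g => by
        obtain ⟨_, k, rfl⟩ := g
        rfl
      map_mul' := fun k k' => Subtype.ext (map_mul (SemidirectProduct.inr : ZH →* Ext i) k k')
      continuous_toFun := (continuous_inr i).subtype_mk
        (fun k : ZH => (⟨k, rfl⟩ : SemidirectProduct.inr k ∈ (SemidirectProduct.inr : ZH →* Ext i).range))
      continuous_invFun := (Semidirect.continuous_right (isInducing_leftRight i)).comp continuous_subtype_val }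
  exact isFreeProSigmaCyclic_primes_ZH.of_continuousMulEquiv e2

/-- **`I_e = (Π_e × 1) × (1 ⋊ Ẑ)` internally in `Π_I`**, given `Z_{F̂₂}(b^Ẑ) = b^Ẑ`: the two factors commute
(the twist fixes `b^Ẑ`), meet trivially and generate. [cite: MochizukiAbsTopII2013, Prop 1.3 (ii) p.11] -/
theorem isInternalProduct_centralizer_node (hZb : Subgroup.centralizer (nodeGp : Set F₂hatT) = nodeGp) :
    IsInternalProduct (nodeGp.map (SemidirectProduct.inl : F₂hatT →* Ext i))
      (SemidirectProduct.inr : ZH →* Ext i).range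
      (Subgroup.centralizer ((nodeGp.map (SemidirectProduct.inl : F₂hatT →* Ext i) : Subgroup (Ext i)) :
          Set (Ext i)) ⊓ (⊤ : Subgroup (Ext i))) := by
  refine ⟨map_inl_node_le_centralizer i hZb, range_inr_le_centralizer i,
    fun a ha b hb => Subgroup.mem_centralizer_iff.mp (range_inr_le_centralizer i hb).1 a ha, ?_, ?_⟩
  · rw [eq_bot_iff]
    rintro g ⟨⟨n, -, hng⟩, ⟨k, rfl⟩⟩
    have h := congrArg SemidirectProduct.right hng
    rw [SemidirectProduct.right_inl, SemidirectProduct.right_inr] at h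
    rw [Subgroup.mem_bot, ← h, map_one]
  · apply le_antisymm (sup_le (map_inl_node_le_centralizer i hZb) (range_inr_le_centralizer i))
    intro g hg
    rw [mem_centralizer_node_inf_top_iff, hZb] at hg
    rw [← SemidirectProduct.inl_left_mul_inr_right g]
    exact Subgroup.mul_mem _ (Subgroup.mem_sup_left ⟨g.left, hg, rfl⟩) (Subgroup.mem_sup_right ⟨g.right, rfl⟩)

/-! ### Transfer to the DPSC vocabulary of `dpsc i hi` (definitional) -/

section Dpsc

variable {i} (hi : 0 < i)

/-- `Π_𝔾 = F̂₂ × 1`. [cite: MochizukiAbsTopII2013, Def 1.2 (ii) p.10] -/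
theorem dpsc_PiG : (dpsc i hi).PiG = (SemidirectProduct.inl : F₂hatT →* Ext i).range := rfl

/-- `Π_I = Π_H`. [cite: MochizukiAbsTopII2013, Def 1.2 (ii) p.10] -/
theorem dpsc_PiI : (dpsc i hi).PiI = ⊤ := rfl

/-- `Π_v = Π_v × 1`. [cite: MochizukiAbsTopII2013, Def 1.2 (ii) p.10] -/
theorem dpsc_vertSub (v : (dpsc i hi).Vert) :
    (dpsc i hi).vertSub v = vertGp.map (SemidirectProduct.inl : F₂hatT →* Ext i) := rfl

/-- `Π_e = b^Ẑ × 1`. [cite: MochizukiAbsTopII2013, Def 1.2 (ii) p.10] -/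
theorem dpsc_nodeSub (e : (dpsc i hi).Node) :
    (dpsc i hi).nodeSub e = nodeGp.map (SemidirectProduct.inl : F₂hatT →* Ext i) := rfl

/-- `Σ = 𝔓𝔯𝔦𝔪𝔢𝔰`. [cite: MochizukiAbsTopII2013, Ex 1.1 (i) p.8] -/
theorem dpsc_Sigma : (dpsc i hi).Sigma = {p | p.Prime} := rfl

/-- `I_v` unfolded. [cite: MochizukiAbsTopII2013, Def 1.2 (ii) p.10] -/
theorem dpsc_Iv (v : (dpsc i hi).Vert) :
    (dpsc i hi).Iv v =
      Subgroup.centralizer ((vertGp.map (SemidirectProduct.inl : F₂hatT →* Ext i) : Subgroup (Ext i)) :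
        Set (Ext i)) ⊓ (⊤ : Subgroup (Ext i)) := rfl

/-- `I_e` unfolded. [cite: MochizukiAbsTopII2013, Def 1.2 (ii) p.10] -/
theorem dpsc_IvNode (e : (dpsc i hi).Node) :
    (dpsc i hi).IvNode e =
      Subgroup.centralizer ((nodeGp.map (SemidirectProduct.inl : F₂hatT →* Ext i) : Subgroup (Ext i)) :
        Set (Ext i)) ⊓ (⊤ : Subgroup (Ext i)) := rfl

/-- **`I_v = 1 ⋊ Ẑ`** at the nodal model, given `Z_{F̂₂}(Π_v) = 1`. [cite: MochizukiAbsTopII2013, Prop 1.3 (iii) p.11] -/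
theorem Iv_dpsc_eq_range_inr (hZv : Subgroup.centralizer (vertGp : Set F₂hatT) = ⊥) (v : (dpsc i hi).Vert) :
    (dpsc i hi).Iv v = (SemidirectProduct.inr : ZH →* Ext i).range :=
  centralizer_vert_inf_top_eq i hZv

/-- **"`I_v ⥲ I`", surjectivity half — the INPUT «`I_v · Π_𝔾 = Π_I`» DISCHARGED at the nodal model**, given
`Z_{F̂₂}(Π_v) = 1`. [cite: MochizukiAbsTopII2013, Prop 1.3 (iii) p.11] -/
theorem Iv_sup_PiG_dpsc (hZv : Subgroup.centralizer (vertGp : Set F₂hatT) = ⊥) (v : (dpsc i hi).Vert) :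
    (dpsc i hi).Iv v ⊔ (dpsc i hi).PiG = (dpsc i hi).PiI := by
  rw [Iv_dpsc_eq_range_inr hi hZv v]
  exact range_inr_sup_range_inl i

/-- "`I_v ⥲ I`", injectivity half: `I_v ∩ Π_𝔾 = 1`, given `Z_{F̂₂}(Π_v) = 1`. [cite: MochizukiAbsTopII2013, Prop 1.3 (iii) p.11] -/
theorem Iv_inf_PiG_dpsc (hZv : Subgroup.centralizer (vertGp : Set F₂hatT) = ⊥) (v : (dpsc i hi).Vert) :
    (dpsc i hi).Iv v ⊓ (dpsc i hi).PiG = ⊥ := by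
  rw [Iv_dpsc_eq_range_inr hi hZv v]
  exact range_inr_inf_range_inl i

/-- **[AbsTopII] Prop 1.3 (ii), first clause "`1 → Π_e → I_e → I → 1`", at the NODAL model** (non-idle: there
IS a node), given the [CombGC] Prop 1.2 (ii)-type input `Z_{F̂₂}(b^Ẑ) = b^Ẑ`: `Π_e ≤ I_e`, `I_e ∩ Π_𝔾 = Π_e`,
`I_e · Π_𝔾 = Π_I`. [cite: MochizukiAbsTopII2013, Prop 1.3 (ii) p.11] -/
theorem prop_1_3_ii_clause1_dpsc (hZb : Subgroup.centralizer (nodeGp : Set F₂hatT) = nodeGp)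
    (e : (dpsc i hi).Node) :
    (dpsc i hi).nodeSub e ≤ (dpsc i hi).IvNode e ∧
      (dpsc i hi).IvNode e ⊓ (dpsc i hi).PiG = (dpsc i hi).nodeSub e ∧
      (dpsc i hi).IvNode e ⊔ (dpsc i hi).PiG = (dpsc i hi).PiI :=
  centralizer_node_clause1 i hZb

/-- **[AbsTopII] Prop 1.3 (ii), second clause "as abstract profinite groups, `I_e ≅ Ẑ^Σ × Ẑ^Σ`", at the NODAL
model** (non-idle), given `Z_{F̂₂}(b^Ẑ) = b^Ẑ`: `I_e` is the internal direct product of the closed free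
pro-`Σ`-cyclic subgroups `A := Π_e = b^Ẑ × 1` and `B := I_v = 1 ⋊ Ẑ` (`Σ = 𝔓𝔯𝔦𝔪𝔢𝔰`).
[cite: MochizukiAbsTopII2013, Prop 1.3 (ii) p.11] -/
theorem prop_1_3_ii_clause2_dpsc (hZb : Subgroup.centralizer (nodeGp : Set F₂hatT) = nodeGp)
    (e : (dpsc i hi).Node) :
    ∃ A B : Subgroup (dpsc i hi).PiH, IsClosed (A : Set (dpsc i hi).PiH) ∧ IsClosed (B : Set (dpsc i hi).PiH) ∧
      IsFreeProSigmaCyclic (dpsc i hi).Sigma A ∧ IsFreeProSigmaCyclic (dpsc i hi).Sigma B ∧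
      IsInternalProduct A B ((dpsc i hi).IvNode e) :=
  ⟨nodeGp.map (SemidirectProduct.inl : F₂hatT →* Ext i), (SemidirectProduct.inr : ZH →* Ext i).range,
    isClosed_map_inl_node i, isClosed_range_inr i, isFreeProSigmaCyclic_map_inl_node i,
    isFreeProSigmaCyclic_range_inr i, isInternalProduct_centralizer_node i hZb⟩

/-- **The first two clauses of the typed `Prop_1_3_ii'` hold at the nodal model, NON-IDLY**, given
`Z_{F̂₂}(b^Ẑ) = b^Ẑ`. [cite: MochizukiAbsTopII2013, Prop 1.3 (ii) p.11] -/
theorem prop_1_3_ii'_left_dpsc (hZb : Subgroup.centralizer (nodeGp : Set F₂hatT) = nodeGp)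
    (e : (dpsc i hi).Node) :
    ((dpsc i hi).nodeSub e ≤ (dpsc i hi).IvNode e ∧
        (dpsc i hi).IvNode e ⊓ (dpsc i hi).PiG = (dpsc i hi).nodeSub e ∧
        (dpsc i hi).IvNode e ⊔ (dpsc i hi).PiG = (dpsc i hi).PiI) ∧
      ∃ A B : Subgroup (dpsc i hi).PiH, IsClosed (A : Set (dpsc i hi).PiH) ∧
        IsClosed (B : Set (dpsc i hi).PiH) ∧
        IsFreeProSigmaCyclic (dpsc i hi).Sigma A ∧ IsFreeProSigmaCyclic (dpsc i hi).Sigma B ∧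
        IsInternalProduct A B ((dpsc i hi).IvNode e) :=
  ⟨prop_1_3_ii_clause1_dpsc hi hZb e, prop_1_3_ii_clause2_dpsc hi hZb e⟩

end Dpsc

end Literature.AnabelianGeometry.AbsoluteAnabelian.AbsTopII.DehnTwist

end
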